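import Mathlib
import Summits.AtomisticToContinuum.HydrodynamicLimit.Theses.ImplosionDichotomy
import Summits.AtomisticToContinuum.HydrodynamicLimit.Theorems.ImplosionDichotomyDenseExcursionR2Package
import Summits.AtomisticToContinuum.HydrodynamicLimit.Theorems.ImplosionDichotomyDenseExcursionR2LagrangeIdentity
import Summits.AtomisticToContinuum.HydrodynamicLimit.Theorems.ImplosionDichotomyDenseExcursionR2ScalingMode
import Summits.AtomisticToContinuum.HydrodynamicLimit.Theorems.ImplosionDichotomyDenseExcursionR2SlavingODE
import Summits.AtomisticToContinuum.HydrodynamicLimit.Theorems.ImplosionDichotomyDenseExcursionR2EntropyTransportZ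
import Summits.AtomisticToContinuum.HydrodynamicLimit.Theorems.ImplosionDichotomyDenseExcursionR2RadialReduction
import Summits.AtomisticToContinuum.HydrodynamicLimit.Theorems.ImplosionDichotomyDenseExcursionR2ChartReading
import Summits.AtomisticToContinuum.HydrodynamicLimit.Theorems.ImplosionDichotomyDenseExcursionR2RotationCovariance
import Summits.AtomisticToContinuum.HydrodynamicLimit.Theorems.ImplosionDichotomyDenseExcursionR2ShrinkingBallLocality
import Summits.AtomisticToContinuum.HydrodynamicLimit.Theorems.ImplosionDichotomyDenseExcursionR2ExteriorAgreement
import Summits.AtomisticToContinuum.HydrodynamicLimit.Theorems.ImplosionDichotomyDenseExcursionR2ExteriorDevelopment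
import Summits.AtomisticToContinuum.HydrodynamicLimit.Theorems.ImplosionDichotomyHsEosLowDensity
import Summits.AtomisticToContinuum.HydrodynamicLimit.Theorems.DenseExcursion.Negative.Dichotomy
import Summits.AtomisticToContinuum.HydrodynamicLimit.Theorems.DenseExcursion.Negative.AtTimeZero
import Summits.AtomisticToContinuum.HydrodynamicLimit.Theorems.DenseExcursion.Negative.Everywhere
import Summits.AtomisticToContinuum.HydrodynamicLimit.Theorems.DenseExcursion.Negative.CompressionBudget
import Summits.AtomisticToContinuum.HydrodynamicLimit.Theorems.DenseExcursion.Negative.AthermalScaling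
import Summits.AtomisticToContinuum.HydrodynamicLimit.Theorems.DenseExcursion.Negative.EntropyTransport
import Summits.AtomisticToContinuum.HydrodynamicLimit.Theorems.DenseExcursion.Negative.Degenerate
import Summits.AtomisticToContinuum.HydrodynamicLimit.Theorems.DenseExcursion.Negative.Untied
import Literature.Analysis.FluidPDE.CompressibleEulerImplosionMonatomicHolds
import Summits.AtomisticToContinuum.HydrodynamicLimit.Theorems.ImplosionDichotomyDenseExcursionSonicCavityDefs
import Summits.AtomisticToContinuum.HydrodynamicLimit.Theorems.ImplosionDichotomyDenseExcursionPackingAnalyticDefs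
import Summits.AtomisticToContinuum.HydrodynamicLimit.Theorems.ImplosionDichotomyDenseExcursionSonicCavityDefsB
import Summits.AtomisticToContinuum.HydrodynamicLimit.Theorems.ImplosionDichotomyDenseExcursionSonicRealBound
import Summits.AtomisticToContinuum.HydrodynamicLimit.Theorems.ImplosionDichotomyDenseExcursionSonicCavityDefsC
import Summits.AtomisticToContinuum.HydrodynamicLimit.Theorems.ImplosionDichotomyDenseExcursionPackingAnalyticDefsB
import Summits.AtomisticToContinuum.HydrodynamicLimit.Theorems.ImplosionDichotomyDenseExcursionSonicConfinementAssembly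
import Summits.AtomisticToContinuum.HydrodynamicLimit.Theorems.ImplosionDichotomyDenseExcursionSonicCavityDefsD
import Summits.AtomisticToContinuum.HydrodynamicLimit.Theorems.ImplosionDichotomyDenseExcursionPackingAnalyticDefsC
import Summits.AtomisticToContinuum.HydrodynamicLimit.Theorems.ImplosionDichotomyDenseExcursionSonicCentreContentBulkTransport
import Summits.AtomisticToContinuum.HydrodynamicLimit.Theorems.ImplosionDichotomyDenseExcursionSonicSlavingStub
import Summits.AtomisticToContinuum.HydrodynamicLimit.Theorems.ImplosionDichotomyDenseExcursionPackingResolventW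

/-!
# Line `sonic-cavity-renewal` — skeleton v9 for crux `DenseExcursion` (stmt-AtomisticToContinuum-12586); lead a2, 2026-08-17

Route `ImplosionDichotomy`, crux (rank 2) `Summit.AtomisticToContinuum.HydrodynamicLimit.Theses.ImplosionDichotomy.DenseExcursion`.

Lineage: v1 (planner, sha256 b15ffe79…) → v2 merge with `packing-analytic-implosion` → v3 vocabulary imported → v4/v5 (wave 1) → v6
(INTEGRATION OF WAVE 1: `stub_realBound` landed p140012; the weighted-`C⁰` cavity resolvent found FALSE and re-typed as
`CavityResolventCk 5`, DefsB p144343; stub-add 06:50Z; wave 2 of seven stub-workers 07:00Z–10:00Z) → v7 (INTEGRATION OF WAVE 2, below) → v8 (INTEGRATION OF WAVE 3, below) → **v9 (this file) = INTEGRATION OF WAVE 4 (five stub-workers 14:35Z–17:25Z, ≈ 55 more accepted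
files)**: `stub_packingResolventW` LANDED (p170029, 14 files: one global weighted maximum principle with four gauges, the acoustic layer by
the exact Cramer normal form + polynomial Bessel comparison + reflection bound; Literature `BarrierTouching` p163903) — imported, FOUR stubs
remain; T6 of the cavity resolvent LANDED off the four genuine jet resonances (`cavity_resolvent_pointwise_offres` p167856 via
`cavity_matching_alternative`, `cavity_resolvent_of_local` p164892, the gap-version Frobenius chain p164030–p164892, a loss-free complex-weight
Volterra construction for `Re ν ≤ −1` p165252–p167856, `sonic_hom_branch_Ck` p167348); Γ's closure DECIDED YES under `PackingResolventW`
(`packingSources_bound_weighted/_twoScale`, `derivRecovery_*_weighted`, `centre_w_bound`, `twoScale_linear_step`, complex Euler/transport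
bricks p163528–p165759; the `N_θ` plan replaced by sup norms on a complex triangle); certified numerics: CavityTube (d) on `x ≤ −1/3` FOR THE
WITNESS (`exists_pinnedProfile_centre_expansion` p167045, chain p163878–p167045 incl. `centre_expansion_certified` p165358), and the generic
complex-wedge chain (Literature `exists_holomorphic_solution_in_tube`, `TaylorModelComplexEval`, disc-certificate format; p165183–p166412) —
blocked on the shared P_s branch-series r-uniform tail engine (no validated x-time integration is possible: interval blow-up 1e16–1e35).
v8 was: INTEGRATION OF WAVE 3 (six stub-workers 11:15Z–13:50Z, ≈ 60 more accepted files): `stub_centreContent` LANDED (p156572 with p155326/p155756: weighted-Levinson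
bulk transport on the certified envelopes, K = 32.2); `stub_sonicSlaving` LANDED as the three-line bridge (…SonicSlavingStub) to the
closed-contour theorem `sonicSlaving_of_wedgeLoop` (p161760; Literature `HolomorphicLinearODEStarConvex` p155712, `LoopSlavingEstimate`
p157822, `SmoothstepPolygon` p159038; wedge continuation p157862; contour p160721) once its hypothesis is the WEDGE-AND-LOOP clause
`CavityTubeWedgeLoop` (…SonicCavityDefsD: part C's wedge data + the certified loop data the sign of the transport exponent needs — the
monotonicity `|t|(1/c₊+1/|c₋|)↑` is not implied by sup-norm bounds; A report §2); T3/T4/T5 of the cavity resolvent LANDED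
(`centre_regular_branch` p160510, `transport_segment` p158456, `exterior_continuation` p156409); the packing-order resolvent's unweighted
`w`-gain found FALSE (acoustic layer at the centre at scale `R ≍ s₀/(kμ)`: `sup|u₁| → 0.367N` independent of `k`; C report §2) and re-typed
with the weight `1/(1+S)` on the `w`-slot, `PackingResolventW` (…PackingAnalyticDefsC; existence half LANDED p157720/p156607, far field
p155801, sonic window p157710, Literature `RepulsiveTransportSup` p156918); Γ's closure machinery LANDED (`analytic_majorant_seeded`,
`packingSources_regular/bound`, `derivRecovery_offSonic`, the `T_ν` lemma `eulerResolvent_smooth_bound`, … 13 files p154993–p159947);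
certified numerics: LEFT barrier `RightL` + `ShootingL` ⇒ `exists_pinnedProfile_window2` p157124 (window `[13890041/12500000, 697/625]`,
width 4.0e-3) and the r-uniform centre-series engine (Literature `OriginSeriesTM`, `CentreCoeffWindow2`, `CentreMajorantWindow2`
p157013–p159145; decisive numerics: centre-series radius = sonic time ≈ 0.43, sharp majorant radius 0.351 ⇒ series certificates reach
`x ≤ −1/3`). Four registered stubs remain in v9 (§2). v7 was:

* LANDED in wave 2 (all ACCEPTED, `--supports`): `stub_largeRealResolventCk` p146926 (+ p145502 weighted-`C^k` finiteness of regular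
  pairs) — true but no longer consumed (see `PackingResolvent`); the `|Im Λ|`-confinement ASSEMBLY `sonicConfinement_of_slaving_of_content`
  p146376 with unique continuation through the sonic point p145331 — imported, so `stub_sonicConfinement` SPLITS here into
  `stub_sonicSlaving` + `stub_centreContent`; T2 of the cavity resolvent in local form `sonic_smooth_branch_Ck_local` p152360 (chain of 11
  files p146377…p152360); smooth radial modes are ANALYTIC at the sonic point `smoothMode_analyticAt_sonic` p147901 (chain p145843,
  p146651, p146783, p147166, p147615); the inner acoustic standing wave at the centre `centre_inner_standing_wave` p152423 (chain of 13,
  p146474…p152986, incl. the weighted Levinson lemma p146594 and the exact reduction `centreContent_of_tube_of_bulk_ratio` p152986);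
  the packing hierarchy AT EVERY ORDER `packingHierarchy_order` p148783 (+ p145341 analytic majorant, p147877, p148860); certified
  numerics: TWO new right barriers (Literature `RightM` p148578/p149024/p149402 at `r* = 697/625`, `RightN` p150999/p151450/p151628/
  p152579 at `1.11385992`, shooting glues p150520/p153010) and the pinned profile on the NARROW window `exists_pinnedProfile_narrow`
  p151043 (`[17307/15625, 697/625]`, `κ ≥ 2/5` discharged), generator `work/stubs/num/genR/` (3 s per barrier, kernel-port regression rc 0).
* RESHAPED in v7 (three stub-misstated / stub-blocked findings of wave 2, each with numbers; NOTES-a2b.md):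
  (i) `stub_analyticPackingImplosion`: the qualitative `LargeRealResolvent` is void at the finitely many orders `kμ < Λ₀` and gives no
  `k`-uniform Laplace gain; replaced by the quantitative `PackingResolvent` (…PackingAnalyticDefsB) + `CavityTube` (sonic analyticity is
  NECESSARY: the sonic locus of `Γ` moves with `G`) — signature = the wave-2 worker's type-checked proposal verbatim; new linear stub
  `stub_packingResolvent` delivers it from `CavityResolventCk 5` (orders `k ≤ 4`, existence; `PinnedRate` keeps `2μ, 3μ` off the `Λ₁`-disc)
  and the honest weighted-`C⁰` theory for `k ≥ 5` (`ν(kμ) < 0`: no loss at the sonic point, gain `1/k`);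
  (ii) `stub_sonicSlaving` takes the WEDGE clause `CavityTubeWedge` (…SonicCavityDefsC: certified analytic continuation of the profile to a
  complex wedge around `[x_m, 0]`): real-axis transport from the sonic point pays `e^{K}`, `K ≥ 33` from tube constants (true 12.35), which no
  finite-order slaving with `C²` data beats; contour transport is suppressed by `e^{−|η||Im Λ|h} ≤ e^{−180}` and closes with constant `0.011`
  vs the registered `2`;
  (iii) `stub_centreContent` takes the BULK clause `CavityTubeBulk` (…SonicCavityDefsC: pointwise envelopes on `[log(1/100), −7/10]`): the
  weighted-Levinson bulk transport closes with honest box-suprema (`K ≈ 38 ≤ 140`) but not with part A's wide (d)-box near `x_m`.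
  The three new data sets are finite lists of explicit inequalities about the explicit pinned profile, validated on `SS(r₂)` with ≥ 1.3×
  slack; they enter only through the ∃-stub `stub_boxPackage` (conclusion extended; speed window narrowed to the certified `[17307/15625,
  697/625]`) and as hypotheses of the ∀-stubs.
* The heart `stub_cavityTrapping` keeps its v6 registered signature (window `≤ 89409/80000 ⊃` the certified one).

Composition (§3, kernel-checked, no hypothesis): `stub_boxPackage` ⇒ pinned `(r, W, S)` + tube A + wedge + bulk + pinned rate + box package;
landed `stub_realBound`; `stub_sonicSlaving` + `stub_centreContent` + landed assembly ⇒ `SonicConfinement`; `strip_of_box` ⇒ strip package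
⇒ `OneModeTwoConditions`; `stub_cavityResolventCk` ⇒ `CavityResolventCk 5`; `gauge_nonresonance_on_pinned_window`; `stub_packingResolvent` ⇒
`PackingResolvent`; `stub_analyticPackingImplosion` ⇒ `Γ` for every analytic excess free energy; `stub_cavityTrapping` ⇒ a `ShadowingChart`;
`tunedPacking_of_chart`, `tunedPacking_iff_denseExcursion` ⇒ `DenseExcursion` BY NAME. (v7: seven registered stubs; v8: five; v9: four.)

Disproof.lean (cdisprove gen 4, unchanged since 2026-08-16T05:32Z; no `-- Targets` for this line): honoured as in v1–v6.
THE BOX: `boxSide = 100`, `boxTop = 1000` as typed; the certifier's contour is what the analytic lemmas leave (`Re Λ ≤ 3` proved,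
`realBound_three` p146474; `|Im Λ| ≤ Y*` from the confinement constants), i.e. `[−1/4, 3] × [−Y*, Y*]`.
-/

noncomputable section

open Filter Set MeasureTheory
open scoped Topology ContDiff

namespace Summit.AtomisticToContinuum.HydrodynamicLimit.Cruxes.DenseExcursion.SonicCavityRenewal

open Literature.MathematicalPhysics.KineticTheory
open Summit.AtomisticToContinuum.HydrodynamicLimit.Theses.ImplosionDichotomy
open Summit.AtomisticToContinuum.HydrodynamicLimit.Theorems.R2OneModeTwoConditions

open Summit.AtomisticToContinuum.HydrodynamicLimit.Theorems.SonicCavityRenewal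
open Summit.AtomisticToContinuum.HydrodynamicLimit.Theorems.PackingAnalyticImplosion

/-! ### §0/§1 Vocabulary and glue: IMPORTED — part A (`…SonicCavityDefs`: OrigProfileEqs, OneModeTwoConditionsStrip, boxSide, boxTop,
InBox, CavityTube, BoxPackage, RealBound, SonicConfinement, strip_of_box, strip_imp_package), part B (`…SonicCavityDefsB`: WCkBound,
CavityResolventCk, matchPoint, slavingCoeff, pWaveContent, SonicSlaving, CentreContent), part C (`…SonicCavityDefsC`: sonicWedge,
CavityTubeWedge, CavityTubeBulk, PinnedRate, packingOrder_avoids_pinnedRate); packing side (`…PackingAnalyticDefs`: gauge_nonresonance_on_pinned_window,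
stiffening, AnalyticPackingImplosion, ShadowingChart, tunedPacking_of_chart; `…PackingAnalyticDefsB`: PackingResolvent); LANDED STUBS
`stub_realBound` (`…SonicRealBound`), `stub_centreContent` (`…SonicCentreContentBulkTransport`), `stub_sonicSlaving` (`…SonicSlavingStub`) and
the assembly `sonicConfinement_of_slaving_of_content` (`…SonicConfinementAssembly`); v8 vocabulary `CavityTubeLoop`, `CavityTubeWedgeLoop`
(`…SonicCavityDefsD`), `PackingResolventW` (`…PackingAnalyticDefsC`). -/

/-! ### §2 The stubs (registered; `sorry` only here) -/

/-- STUB 1 `stub_boxPackage` (CERTIFIED NUMERICS, size XL — a campaign, ≈ 12 sessions left; v8: window NARROWED to the certified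
`[13890041/12500000, 697/625]` (p157124) and the wedge clause replaced by the wedge-and-loop clause `CavityTubeWedgeLoop`): THE PINNED PROFILE WITH ITS CAVITY TUBE (parts
A, wedge, bulk), ITS PINNED RATE AND ITS BOX PACKAGE. What is landed towards it: `exists_pinnedProfile_narrow` (p151043: the ∃-witness on this
window with CavityTube (a).1–3 and (a).5), the right-barrier generator. What is left (W7 report §7, wave-1 report §B2–B4): a left barrier
at `r ≈ 1.1112` (1 session), the sharp centre/sonic series engines (r-uniform Taylor models) ⇒ (d), (e), wedge, bulk (3–4), phase-plane
sandwich ⇒ (a).4, (b), (c) (3–4), pinning to ±3e-5 (2), the validated linear-ODE/Evans engine ⇒ `PinnedRate`, simplicity, kernel/Jordan at 0,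
argument principle on `[−1/4, 3] × [−Y*, Y*]` (6–8 + compute). Numerically true (seven codes). -/
theorem stub_boxPackage :
    ∃ (r : ℝ) (W S : ℝ → ℝ), ((13890041 / 12500000 : ℝ) ≤ r ∧ r ≤ 697 / 625) ∧ IsMonatomicProfile r W S ∧
      OrigProfileEqs r W S ∧ CavityTube r W S ∧ CavityTubeWedgeLoop r W S ∧ CavityTubeBulk r W S ∧ PinnedRate r W S ∧
      BoxPackage r W S := by
  sorry

/-! STUB 2 `stub_realBound` — LANDED (p140012, `…Theorems.SonicCavityRenewal.stub_realBound`, imported; proved bound `Re Λ ≤ 3`). -/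

/-! STUB 3a `stub_sonicSlaving` — LANDED (v8 bridge `…SonicSlavingStub` to `sonicSlaving_of_wedgeLoop` p161760; hypothesis `CavityTubeWedgeLoop`).
STUB 3b `stub_centreContent` — LANDED (p156572, `…SonicCentreContentBulkTransport`). Both imported. -/

/-- STUB 4 `stub_cavityResolventCk` (ANALYTIC, size L; v6 conclusion, v8 hypotheses = the narrow window + wedge-and-loop + bulk; T3, T4, T5 LANDED in
wave 3: `centre_regular_branch` p160510 (+ `centre_regular_unique` p159361), `transport_segment` p158456, `exterior_continuation` p156409): THE UNIFORM
WEIGHTED-`C⁵ → C⁰` RESOLVENT OF THE CAVITY, `CavityResolventCk 5 r W S`, on `{Re Λ ≥ −1/5} ∖ (1/20-discs at 0, Λ₁, r)`. LANDED: uniqueness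
(`cavityResolvent_unique` p139291), exponent data (p139517), T2 local (`sonic_smooth_branch_Ck_local` p152360 with its Frobenius-pair machinery
`sonic_char_branch`, `frobenius_pair_of_series`, `euler_smooth_solution`). LEFT (W4 report §3): (T2′) uniformity in `Im Λ` at fixed `δ` on
`−1/5 ≤ Re Λ ≤ boxSide` (= the slaving mechanism of stub 3a, wedge data); (T3) centre-regular branch (Fuchs in `e^{2x}`, same `IsFrobeniusData`
machinery; uniformity = the inner analysis of stub 3b); (T4) transport on non-characteristic segments; (T5) exterior continuation; (T6) matching
with the pole-free Evans function (existence also at the ≤ 4 real jet resonances — numerically smooth through them, NUMERICS-a2 §2); (T7)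
uniformity: compact part by continuity in `Λ`, `|Im Λ| → ∞` by 3a/3b's mechanisms, `Re Λ → ∞` by energy. -/
theorem stub_cavityResolventCk :
    ∀ (r : ℝ) (W S : ℝ → ℝ), (17307 / 15625 : ℝ) ≤ r → r ≤ 697 / 625 →
      IsMonatomicProfile r W S → OrigProfileEqs r W S → CavityTube r W S → CavityTubeWedgeLoop r W S → CavityTubeBulk r W S →
      BoxPackage r W S → RealBound r W S → SonicConfinement r W S → CavityResolventCk 5 r W S := by
  sorry

/-! STUB 5 `stub_packingResolventW` — LANDED (p170029, `…Theorems.PackingAnalyticImplosion.stub_packingResolventW`, imported). -/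

/-- STUB 6 `stub_analyticPackingImplosion` (THE COMPANION LINE'S LEVER, size L; v7 = the wave-2 worker's corrected signature; v8: linear input
`PackingResolventW`; closure machinery LANDED in wave 3: `analytic_majorant_seeded`, `packingSources_regular`, `packingSources_bound`, `majorant_shift`,
`stiffening_jet_bound`, `derivRecovery_offSonic` (no far-field data needed), the `T_ν` lemma `eulerResolvent_smooth_bound`, damped-transport a-priori
bounds — p154993…p159947; LEFT: `sonicWindow_analytic_bound`, `implosion_of_summable_hierarchy`, and the two-scale bookkeeping at the centre forced
by the weighted gain, D/C reports): **THE HARD-SPHERE GAS IMPLODES ALONG ITS OWN VIRIAL SERIES.** For a profile in the BCG window with its equations, the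
`(1,2)` package and the gauge clause (making the hierarchy canonical, `hierarchy_solution_unique`), the cavity tube part A (sonic analyticity is
NECESSARY: the sonic locus of `Γ` moves with `G`) and the packing-order resolvent, and for every excess free energy `F` analytic near `0` with
`F 0 = 0`, the analytic packing implosion `Γ` exists for `M = stiffening F`. LANDED: the hierarchy at every order `packingHierarchy_order`
(p148783: `(kμ − L)X_k = Src_k` with explicit `Src_k`), `familyCoeff_stiffening` (p148860), `analytic_majorant` (p145341), sub-Catalan majorant
(p139246), order one (p139956), stiffening jets/analyticity (p140201, p140258). LEFT (W6 report §4–§5, the function-space decision): weighted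
`C⁰` linear input (`PackingResolvent`) + `C¹` recovered algebraically off the sonic window + a `k`- and `x`-weighted real-analytic sup scale
`N_θ` on the certified sonic window `|x| < 1/10` (`C^ω` in `x` there and only there), closure by `analytic_majorant` (seeded variant), a
posteriori joint smoothness and centre regularity of the sum: `packingSources_regular` (M), `derivRecovery_offSonic` (M),
`sonicWindow_analytic_bound` (L), `analytic_majorant_seeded` (S), `implosion_of_summable_hierarchy` (L). Numerics: radius `R_G ≈ 0.086`. -/
theorem stub_analyticPackingImplosion :
    ∀ (r : ℝ) (W S : ℝ → ℝ), 11 / 10 < r → r < 227 / 200 → IsMonatomicProfile r W S →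
      (∀ x, (W x - 1) * deriv W x + 3 * S x * deriv S x = r * W x - W x ^ 2 - 3 * S x ^ 2 ∧
        (1 - W x) * deriv S x - S x / 3 * deriv W x = S x * (2 * W x - r)) →
      OneModeTwoConditions r W S → (∀ k : ℕ, (k : ℝ) * (3 * (r - 1)) ≠ r) →
      CavityTube r W S → PackingResolventW r W S →
      ∀ (F : ℝ → ℝ) (η₀ : ℝ), 0 < η₀ → AnalyticOnNhd ℝ F (Set.Ioo (-η₀) η₀) → F 0 = 0 →
        AnalyticPackingImplosion r W S (stiffening F) := by
  sorry

/-- STUB 7 `stub_cavityTrapping` (THE HEART, size XL, held by the lead; v2 RESHAPED = the companion's residual heart H′ GIVEN this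
line's linear theory; v6: speed in the PINNED window, linear theory = `CavityResolventCk 5`): **SHADOWING THE ANALYTIC PACKING IMPLOSION
WITH THE CAVITY RESOLVENT IN HAND.** For the pinned profile (speed in `[17307/15625, 89409/80000] ⊂ (11/10, 227/200)`) with its
original-form equations, the cavity tube, the strip package, the constructive weighted-`C⁵` cavity resolvent, the gauge
non-resonance, and the analytic packing implosion `Γ` for every analytic excess free energy (instantiated inside at the `F` of
`hsEosLowDensity_proof`, so that `Γ` is an EXACT classical solution of the actual hard-sphere system in the exactly invariant
isentropic class — `RadialReduction`, `SelfSimilarCovariance`, `EntropyTransportZ`, landed), a `ShadowingChart` exists. Content =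
NOTES-c5 §3 Deltas 2–4 with Delta 1 (linear theory: now the HYPOTHESIS `CavityResolventCk 5`, Laplace-inverted along `Re Λ = −1/5`
with two integrations by parts ⇒ `e^{τL} = residues at {Λ₁, r, 0} + O_{C⁰_w}(e^{−τ/5}‖·‖_{C⁷_w})`) and the reference object (now the
HYPOTHESIS `Γ`: no forcing, no growing window relative to `Γ`, only an `O(σ³)` data mismatch with explicit jets) both supplied:
(B) UNFORCED codimension-one nonlinear trapping near the stable leaf of `Γ|_{G ≤ η₀}` in shooting form (Brouwer in the one unstable
coordinate; two-tier scheme: high-order weighted energy/transport tier closed by repulsivity from tube (b) alone, low-order tier by the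
resolvent's decay with the loss absorbed by interpolation; quasilinear terms and the `O(η₀)` drift of `Γ` as coefficients), modulation
of the gauge and scaling symmetries (`gauge_isSmoothRadialMode`, `ScalingMode`), existence on `𝕋³` by continuation with exterior
control (`HsChartReading`, `ChartRotationCovariance`, `ShrinkingBallLocality`, `ExteriorAgreement`, `ExteriorDevelopment`, all landed)
⇒ `window`; (C) the threshold two-jet from the finite-time analytic dependence of the pinned data on `ε = σ³` (`TiedStatics`) against the
`C^{2,α}` pseudo-stable leaf of the `Γ`-curve ⇒ `jets`, `a1, a2` continuous, `a1 = ℓ₁(ĥ₁ − cX₁)` for the exact-seed member (cubic in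
`1 + bT` along the Kidder knob by `ProjectiveCovariance`); (D) selection (`a0` puts the base member on the `σ = 0` leaf) and the two
tunings (`bZero`: transversal root of the cubic, `b₀T = −0.4234`; `a2` changes sign along it: `G₂ = +0.0905 → −0.015` across
`β ∈ [0, 16 %]`, zero near `13.8 %`, c2-0) ⇒ `a1_zero`, `a1_sign`, `bottom`, `top`. Printed templates: ChenShkollerVicol2026
(arXiv:2605.00808 Thm 1.3, §1.10–1.11: radial, non-isentropic, weighted `L^∞` with singular weights), CaolaboraEtAl2025
(arXiv:2310.05325 Thm 1.2), MerleEtAl2022; no printed theorem treats a non-scale-invariant pressure law (Disproof §8.5) — this stub is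
the crux's substance minus the linear theory, the spectral certificate and the reference object. Why it might fail: the sign change of
`a2` along `{a1 = 0}` does not survive certification at `SS(r₂)` (then `SS(r₄)`, `J = 4`), or the γ = 5/3 repulsivity inequalities fail in
the norm the bootstrap needs. Sources: as cited; NOTES-c3 §Heart, NOTES-c4 blueprint, NOTES-c5 §3, NOTES-c8 §3, NOTES-c2 (G₂). -/
theorem stub_cavityTrapping :
    ∀ (r : ℝ) (W S : ℝ → ℝ), (17307 / 15625 : ℝ) ≤ r → r ≤ 89409 / 80000 → IsMonatomicProfile r W S → OrigProfileEqs r W S →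
      CavityTube r W S → OneModeTwoConditionsStrip r W S → CavityResolventCk 5 r W S →
      (∀ k : ℕ, (k : ℝ) * (3 * (r - 1)) ≠ r) →
      (∀ (F : ℝ → ℝ) (η₀ : ℝ), 0 < η₀ → AnalyticOnNhd ℝ F (Set.Ioo (-η₀) η₀) → F 0 = 0 →
        AnalyticPackingImplosion r W S (stiffening F)) →
      Nonempty ShadowingChart := by
  sorry

/-! ### §3 Composition (kernel-checked, no stub inside, NO hypothesis): the stubs give the crux BY NAME -/

/-- `DenseExcursion` from the four open stubs and the landed ones, unconditionally (REAL proof; its only gaps are the registered stubs). -/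
theorem DenseExcursion_of : DenseExcursion := by
  obtain ⟨r, W, S, ⟨hlo0, hhi⟩, hP, hE, hT, hWedge, hBulk, hRate, hbox⟩ := stub_boxPackage
  have hlo : (17307 / 15625 : ℝ) ≤ r := le_trans (by norm_num) hlo0
  have hhi' : r ≤ 89409 / 80000 := hhi.trans (by norm_num)
  have hr₁ : (11 / 10 : ℝ) < r := by linarith
  have hr₂ : r < 227 / 200 := by linarith
  have hre : RealBound r W S := stub_realBound r W S hP hE hT
  have hslav : SonicSlaving r W S := stub_sonicSlaving r W S hlo hhi hP hE hT hWedge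
  have hcont : CentreContent r W S := stub_centreContent r W S hlo hhi hP hE hT hBulk
  have him : SonicConfinement r W S := sonicConfinement_of_slaving_of_content r W S hP hT hslav hcont
  have hstrip : OneModeTwoConditionsStrip r W S := strip_of_box hP hbox hre him
  have hres : CavityResolventCk 5 r W S := stub_cavityResolventCk r W S hlo hhi hP hE hT hWedge hBulk hbox hre him
  have hgauge : ∀ k : ℕ, (k : ℝ) * (3 * (r - 1)) ≠ r := gauge_nonresonance_on_pinned_window hlo hhi'
  have hPR : PackingResolventW r W S := stub_packingResolventW r W S hlo hhi hP hE hT hWedge hBulk hbox hre him hres hRate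
  have hΓ : ∀ (F : ℝ → ℝ) (η₀ : ℝ), 0 < η₀ → AnalyticOnNhd ℝ F (Set.Ioo (-η₀) η₀) → F 0 = 0 →
      AnalyticPackingImplosion r W S (stiffening F) :=
    fun F η₀ hη₀ hF hF0 =>
      stub_analyticPackingImplosion r W S hr₁ hr₂ hP hE (strip_imp_package hstrip) hgauge hT hPR F η₀ hη₀ hF hF0
  obtain ⟨Ch⟩ := stub_cavityTrapping r W S hlo hhi' hP hE hT hstrip hres hgauge hΓ
  exact tunedPacking_iff_denseExcursion.mp (tunedPacking_of_chart Ch)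

end Summit.AtomisticToContinuum.HydrodynamicLimit.Cruxes.DenseExcursion.SonicCavityRenewal

end
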